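import Mathlib
import Summits.Ventures.PercRepro2.TypedTwoTerminalConn

/-!
# The terminal transfer for an arbitrary part, and masked states (blind cell PercRepro2, p2 g3,
2026-08-25) — the vocabulary of the hyperstar program in the kernel

Let `L` be a set of edges and `I` a set of INTERNAL vertices (every edge at a vertex of `I` off
`L` closed). What the rest of the graph sees of `L` in a configuration `ω` is the TERMINAL RELATION
`tRel`: two vertices off `I` joined through the open edges of `L`. The MASK GRAPH
`openGraph ends (ω with L closed) ⊔ fromRel tRel` has the same connections among the vertices off
`I` as `ω` (`conn_mask`: the closure-lemma induction of `conn_twoTerminal` for an arbitrary part —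
no hypothesis on the ends of `L` at all). Hence the 7-coordinate state of the crux kernel is the
MASKED STATE `stG` of the mask graph (`st_mask`): the kernel at a placement of `L` is the kernel
at the masked base — per-copy clique masks on the terminals, the objects of mine-1 §25's hyperstar
language, now on any base. The counting identity is `TypedMask.lean`.
-/

namespace Summit.Ventures.PercRepro2

namespace CovForm

namespace TypedRed

namespace Mask

open TwoTerm OneTyped

section Conn

variable {V : Type*} {E : Type*} [DecidableEq E]

/-- The terminal relation of a configuration `a` (read on its open edges): two vertices off `I`
joined through `a`. -/
def tRel (ends : E → Sym2 V) (I : Set V) (a : Config E) (x y : V) : Prop :=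
  x ∉ I ∧ y ∉ I ∧ Conn ends a x y

/-- The mask graph of `ω` with respect to the part `(I, L)`: `L` closed, the terminal relation of
the `L`-part added. -/
def maskGraph (ends : E → Sym2 V) (I : Set V) (L : Finset E) (ω : Config E) : SimpleGraph V :=
  openGraph ends (offL L ω) ⊔ SimpleGraph.fromRel (tRel ends I (onL L ω))

/-- **The terminal transfer.** For `p, q ∉ I`: `p ↔ q` in `ω` iff `p ↔ q` in the mask graph. -/
theorem conn_mask {ends : E → Sym2 V} {I : Set V} {L : Finset E} (ω : Config E)
    (hcl : ∀ e, e ∉ L → (∃ x ∈ I, x ∈ ends e) → ω e = false) {p q : V} (hp : p ∉ I)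
    (hq : q ∉ I) :
    Conn ends ω p q ↔ (maskGraph ends I L ω).Reachable p q := by
  -- a terminal pair joined through the `L`-part is reachable in the mask graph
  have hpair : ∀ x y : V, x ∉ I → y ∉ I → Conn ends (onL L ω) x y →
      (maskGraph ends I L ω).Reachable x y := fun x y hx hy hc => by
    by_cases hxy : x = y
    · subst hxy; exact SimpleGraph.Reachable.refl _
    · exact SimpleGraph.Adj.reachable (by
        rw [maskGraph, SimpleGraph.sup_adj, SimpleGraph.fromRel_adj]
        exact Or.inr ⟨hxy, Or.inl ⟨hx, hy, hc⟩⟩)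
  constructor
  · intro hpq
    let S : Set V := {x | (x ∉ I ∧ (maskGraph ends I L ω).Reachable p x) ∨
      (x ∈ I ∧ ∃ r, r ∉ I ∧ (maskGraph ends I L ω).Reachable p r ∧ Conn ends (onL L ω) r x)}
    have hpS : p ∈ S := Or.inl ⟨hp, SimpleGraph.Reachable.refl _⟩
    have hclosed : ∀ x ∈ S, ∀ y, (openGraph ends ω).Adj x y → y ∈ S := by
      intro x hx y hxy
      rw [openGraph_adj] at hxy
      obtain ⟨hne, e, he, hends⟩ := hxy
      have hxe : x ∈ ends e := by rw [hends]; exact Sym2.mem_mk_left x y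
      have hye : y ∈ ends e := by rw [hends]; exact Sym2.mem_mk_right x y
      by_cases heL : e ∈ L
      · have hconnL : Conn ends (onL L ω) x y :=
          conn_of_openAdj ⟨e, by rw [onL_of_mem heL]; exact he, hends⟩
        rcases hx with ⟨hxI, hpx⟩ | ⟨hxI, r, hrI, hpr, hrx⟩
        · by_cases hyI : y ∈ I
          · exact Or.inr ⟨hyI, x, hxI, hpx, hconnL⟩
          · exact Or.inl ⟨hyI, hpx.trans (hpair x y hxI hyI hconnL)⟩
        · have hry : Conn ends (onL L ω) r y := conn_trans hrx hconnL
          by_cases hyI : y ∈ I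
          · exact Or.inr ⟨hyI, r, hrI, hpr, hry⟩
          · exact Or.inl ⟨hyI, hpr.trans (hpair r y hrI hyI hry)⟩
      · have hxI : x ∉ I := fun hxI => by
          have := hcl e heL ⟨x, hxI, hxe⟩; rw [he] at this; exact Bool.noConfusion this
        have hyI : y ∉ I := fun hyI => by
          have := hcl e heL ⟨y, hyI, hye⟩; rw [he] at this; exact Bool.noConfusion this
        have hadj : (maskGraph ends I L ω).Adj x y := by
          rw [maskGraph, SimpleGraph.sup_adj, openGraph_adj]
          exact Or.inl ⟨hne, e, by rw [offL_of_not_mem heL]; exact he, hends⟩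
        rcases hx with ⟨_, hpx⟩ | ⟨hxI', _⟩
        · exact Or.inl ⟨hyI, hpx.trans hadj.reachable⟩
        · exact absurd hxI' hxI
    have hqS : q ∈ S := mem_of_conn_of_closed hclosed hpS hpq
    rcases hqS with ⟨_, h⟩ | ⟨hqI, _⟩
    · exact h
    · exact absurd hqI hq
  · intro hpq
    clear hp hq
    rw [SimpleGraph.reachable_iff_reflTransGen] at hpq
    induction hpq with
    | refl => exact conn_refl _ _ _
    | tail _ hxy ih =>
      refine conn_trans ih ?_
      rw [maskGraph, SimpleGraph.sup_adj, openGraph_adj, SimpleGraph.fromRel_adj] at hxy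
      rcases hxy with ⟨_, e, he, hends⟩ | ⟨_, h | h⟩
      · have heL : e ∉ L := fun heL => by
          rw [offL_of_mem heL] at he; exact Bool.noConfusion he
        rw [offL_of_not_mem heL] at he
        exact conn_of_openAdj ⟨e, he, hends⟩
      · exact conn_mono (onL_le L ω) h.2.2
      · exact conn_symm (conn_mono (onL_le L ω) h.2.2)

end Conn

/-! ## Masked states -/

section State

open Classical

variable {V : Type*} {E : Type*} [DecidableEq E]

/-- The 7-coordinate state read in an arbitrary graph. -/
noncomputable def stG (o a₁ a₂ a₃ b : V) (G : SimpleGraph V) : St :=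
  (decide (G.Reachable a₂ a₁), decide (G.Reachable a₁ o), decide (G.Reachable a₂ o),
    decide (G.Reachable a₁ b), decide (G.Reachable a₂ b), decide (G.Reachable a₁ a₃),
    decide (G.Reachable a₂ a₃))

omit [DecidableEq E] in
/-- The state of a configuration is the state of its open graph. -/
lemma st_eq_stG (ends : E → Sym2 V) (o a₁ a₂ a₃ b : V) (ω : Config E) :
    st ends o a₁ a₂ a₃ b ω = stG o a₁ a₂ a₃ b (openGraph ends ω) := by
  unfold st stG Conn
  rfl

/-- **The masked state**: the state of `ω` is the state of its mask graph, the marks lying off `I`. -/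
theorem st_mask (ends : E → Sym2 V) (o a₁ a₂ a₃ b : V) {I : Set V}
    (hI : ∀ x ∈ I, x ≠ o ∧ x ≠ a₁ ∧ x ≠ a₂ ∧ x ≠ a₃ ∧ x ≠ b) (L : Finset E) (ω : Config E)
    (hcl : ∀ e, e ∉ L → (∃ x ∈ I, x ∈ ends e) → ω e = false) :
    st ends o a₁ a₂ a₃ b ω = stG o a₁ a₂ a₃ b (maskGraph ends I L ω) := by
  have ho : o ∉ I := fun h => (hI o h).1 rfl
  have h1 : a₁ ∉ I := fun h => (hI a₁ h).2.1 rfl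
  have h2 : a₂ ∉ I := fun h => (hI a₂ h).2.2.1 rfl
  have h3 : a₃ ∉ I := fun h => (hI a₃ h).2.2.2.1 rfl
  have hb : b ∉ I := fun h => (hI b h).2.2.2.2 rfl
  have key := fun {p q : V} (hp : p ∉ I) (hq : q ∉ I) => conn_mask (L := L) ω hcl hp hq
  unfold st stG
  simp only [Prod.mk.injEq]
  exact ⟨decide_eq_decide.mpr (key h2 h1), decide_eq_decide.mpr (key h1 ho),
    decide_eq_decide.mpr (key h2 ho), decide_eq_decide.mpr (key h1 hb),
    decide_eq_decide.mpr (key h2 hb), decide_eq_decide.mpr (key h1 h3),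
    decide_eq_decide.mpr (key h2 h3)⟩

/-- The mask graph of a patched configuration: the base's open graph with the terminal relation of
the placement. -/
lemma maskGraph_patchL (ends : E → Sym2 V) (I : Set V) {L : Finset E} {a x : Config E}
    (ha : ∀ e, e ∉ L → a e = false) (hx : ∀ e ∈ L, x e = false) :
    maskGraph ends I L (patchL L a x) = openGraph ends x ⊔ SimpleGraph.fromRel (tRel ends I a) := by
  rw [maskGraph, offL_patchL a hx, onL_patchL ha x]

end State

end Mask

end TypedRed

end CovForm

end Summit.Ventures.PercRepro2
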